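import Literature.Geometry.Lorentzian.PlaneWaveMinkowskiLimit
import Literature.Geometry.Lorentzian.SpacetimeLocalConvergenceTilt
import HarnessLib

/-!
# The plane-wave-to-Minkowski datum is not tilt-bounded
(topic `Geometry/Lorentzian`; the example of `PlaneWaveMinkowskiLimit.lean` read through the
frame-bound clause of `SpacetimeLocalConvergenceTilt.lean`; Geroch 1969, §3)

The comparison maps `boost cₙ` of the datum `PlaneWave.minkowskiLimit k` (the homogeneous plane
wave has Minkowski space as a pointed `Cᵏ_loc` limit) have tilt EXACTLY `(cₙ + cₙ⁻¹)/2` at the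
base point (`tilt_minkowskiLimit`) — the hyperbolic cosine of the rapidity `−log cₙ` of the boost —
which is `≥ n + 2`; so the datum is not tilt-bounded (`not_isTiltBounded_minkowskiLimit`). This is
the quantitative form of "the degeneration behind the non-uniqueness of Lorentzian pointed limits is
an unbounded boost", and the reason a tilt/frame bound is the natural clause to add to hull and
limit-set notions built on `SubconvergesLocallyTo`.

## References
* [Geroch1969] R. Geroch, *Limits of spacetimes*, Comm. Math. Phys. 13 (1969) 180–193, §3.
* [Anderson2004] M. T. Anderson, *Cheeger–Gromov theory and applications to general relativity*, 2004, §5.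
-/

noncomputable section

open TopologicalSpace Manifold Filter Topology Set Function Metric

namespace Literature.Geometry.Lorentzian

namespace PlaneWave

/-- At the origin the orienting field of the plane wave is `∂₀` (`H(0) = 0`). [folklore] -/
theorem timeVector_zero : timeVector 0 = E4.basisVector 0 := by
  simp [timeVector, profile]

/-- `g_0(∂₀, ∂₀) = −1` at the origin of the plane wave. [folklore] -/
theorem bilin_zero_basisVector_zero :
    bilin 0 (E4.basisVector 0) (E4.basisVector 0) = -1 := by
  rw [bilin_apply, Minkowski.bilin_basisVector_zero]
  simp [profile]

/-- **The tilt of the `n`-th boost is `(cₙ + cₙ⁻¹)/2`.** [cite: Geroch1969, §3] -/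
theorem tilt_minkowskiLimit (k n : ℕ) :
    (minkowskiLimit k).tilt n = (boostParam n + (boostParam n)⁻¹) / 2 := by
  have hl : ell (E4.basisVector 0) = 1 := by simp [Fin.ext_iff]
  have hn : enn (E4.basisVector 0) = 1 := by simp [Fin.ext_iff]
  have hc := boostParam_ne_zero n
  -- unfold the datum: comparison map `boost cₙ`, base point `0`, orienting fields `∂₀` / `T`
  have hm : (show E4 from mfderiv 𝓘(ℝ, E4) (𝓡 4) ((minkowskiLimit k).embed n) (0 : E4)
      (E4.basisVector 0)) = boost (boostParam n) (E4.basisVector 0) :=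
    mfderiv_boost (boostParam n) 0 (E4.basisVector 0)
  have h0 : (show E4 from (minkowskiLimit k).embed n (0 : E4)) = 0 := map_zero (boost (boostParam n))
  unfold Spacetime.LocalSubconvergence.tilt
  show -(bilin (boost (boostParam n) 0)
      (show E4 from mfderiv 𝓘(ℝ, E4) (𝓡 4) ((minkowskiLimit k).embed n) (0 : E4)
        (E4.basisVector 0))
      (timeVector (boost (boostParam n) 0))) /
      (Real.sqrt (-Minkowski.bilin (E4.basisVector 0) (E4.basisVector 0)) *
        Real.sqrt (-bilin (boost (boostParam n) 0) (timeVector (boost (boostParam n) 0))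
          (timeVector (boost (boostParam n) 0)))) = _
  rw [hm, map_zero, timeVector_zero, bilin_zero_basisVector_zero, Minkowski.bilin_basisVector_zero,
    neg_neg, Real.sqrt_one, mul_one, div_one, bilin_apply, Minkowski.bilin_symm,
    Minkowski.bilin_basisVector_zero_left, boost_apply_zero, hl, hn]
  simp [profile]

/-- The tilt of the `n`-th boost is at least `n + 2`. [folklore] -/
theorem le_tilt_minkowskiLimit (k n : ℕ) : (n : ℝ) + 2 ≤ (minkowskiLimit k).tilt n := by
  rw [tilt_minkowskiLimit]
  have hc := boostParam_pos n
  have hinv : (boostParam n)⁻¹ = 2 * ((n : ℝ) + 2) := by rw [boostParam, inv_inv]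
  rw [hinv]
  nlinarith

/-- **The plane-wave-to-Minkowski datum is not tilt-bounded.** [cite: Geroch1969, §3] -/
theorem not_isTiltBounded_minkowskiLimit (k : ℕ) : ¬ (minkowskiLimit k).IsTiltBounded := by
  rintro ⟨C, hC⟩
  obtain ⟨n, hn⟩ := exists_nat_gt C
  have h := (le_tilt_minkowskiLimit k n).trans (hC n)
  linarith

end PlaneWave

end Literature.Geometry.Lorentzian
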